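import Summits.QuantumFields.BalabanUV.Beta.LagrangeFoldMixed
import Summits.QuantumFields.BalabanUV.Beta.MultiplierTableSlot
import Summits.QuantumFields.BalabanUV.Beta.RecursiveStencilSlot

/-!
# `BalabanUV.Beta.LagrangeFoldSym` — binder row D1, the K PART of the ORDER-ONE CONSISTENCY (c1) for the (0.4) literal, step 2: **THE Λ-SECTOR
# OF THE SLOTTED FIRST-ORDER TABLES, READ THROUGH THE SYMMETRISED RESOLVENTS, IS THE MULTIPLIER-COLUMN VERTEX OF `M1Of H cΛ`** — hence (c1) at
# `(G, S, M) := (Gsym, SpureRecOf V H Gsym, M1Of H cΛ)`: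
# `dM (Gsym Lc j) Lc (SpureRecOf … j) (M1Of d Lc H cΛ j) μ y = vertexOfK (Gsym Lc j) Lc (SrecOf … j) μ y`, EVERY level, for ANY tables `V`, `H`
# with the letters (LV)(LH) — the sym twin of leaf-10's `LagrangeFoldLiteral` + `LagrangeFoldSrec`, by FACTORISATION (`LagrangeFoldMixed`) instead of
# blindness + chart (I) (β sub-cell, BINDER-OWNERS row D1 OWNER `b2b-balaban-beta-an2`, gen 29; successor brick of [AN2-G29-LANDED-WARD])

HONEST FRAMING (cell charter, verbatim): «discharging BetaPertH makes Bałaban's UV stability UNCONDITIONAL — a real constructive-QFT result; it is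
NOT the continuum limit and NOT the Clay problem.»  HONEST DEPENDENCY: continuum YM on T⁴ ⇐ BetaPertH ∧ nine spine estimates (0/9 proved);
BetaPertH ⇐ (D1) ∧ (D4) ∧ CAP+tail; G-an2-4 gates asym, D1 and NE2/3/4.
NOT IN PRINT; OUR BOOKKEEPING.  [folklore] kernel algebra over tree objects BY NAME (leaf-10's generic `LagrangeFold.vertexOfK_smul_SLam_lamCoeffK`,
`LagrangeFoldZero.lamCoeffOf_eq_lamCoeffK`, `ChartConjugationReflection.vertexOfK_add`; step 1 `LagrangeFoldMixed`; the slot files `MultiplierTableSlot` ∕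
`RecursiveStencilSlot`); no statement of Bałaban's papers, no `[cite:]`, no `def`, no `def … : Prop`; instantiates NO binder of the β-function wall.  It makes
the K part of the root's letter (c1) (`RowD1JointEndSymWard`) a THEOREM; the TABLE part — an1's value `tabs.M = M1Of tabs.H cΛ` — stays a letter.  NOT D1,
NOT `BetaPertH`, NOT continuum, NOT Clay.

* §1 `vertexOfM_mixed_sandwich_E2_sym` ∕ `vertexOfM_mixed_sandwich_zero_sym` (from step 1's `colM` identities).
* §2 **`vertexOfK_lagrangePiece_sym_succ`**: `vertexOfK (Gsym Lc (j+1)) Lc (κ u ↦ c • SLam Lc (lamCoeffK (KInvStep Lc (j+1)) (E2 (j+1)) Lc) Q κ u) μ y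
  = (c ∕ wVH (j+1)) • vertexOfM (Gsym Lc (j+1)) Lc Q μ y` (STRAIGHT coefficients, DRESSED reading — sign PLUS); **`vertexOfK_lagrangePiece_sym_zero`**:
  `vertexOfK (Gsym Lc 0) Lc (κ u ↦ c • SLam Lc (lamCoeffOf (KInv Lc) Lc) Q κ u) μ y = c • vertexOfM (Gsym Lc 0) Lc Q μ y`.
* §3 **`vertexOfK_lagrangePiece_sym_eq_M1Of`** (every level, the weights of `SrecOf`: `cΛ·wΛ (j+1)` ∕ `cΛ`; `wΛ = wM1·wVH`, `wM1 0 = 1`).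
* §4 **`dM_SpureRecOf_M1Of_eq_vertexOfK_SrecOf`** — (c1) AT THE SYMMETRISED RESOLVENTS FOR THE SLOTTED TABLES, every level (`vertexOfK_add` with the
  uniform bounds of `SpureRecOf`∕`SrecOf` from (LV)(LH)(DG)).
Provenance: β sub-cell, unit beta-an2 gen 29, 2026-08-21 (v1); over the files named above BY NAME; no existing file touched.
-/

noncomputable section

open Finset
open scoped BigOperators
open Literature.MathematicalPhysics.QuantumFieldTheory
open Literature.MathematicalPhysics.QuantumFieldTheory.Balaban1983to89
open Literature.MathematicalPhysics.QuantumFieldTheory.Balaban1983to89.Beta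
open B12Sec2to5 (l1 l1_nonneg)
open ExpKernelCalculus (MKer Decays VertexFamily comp)
open KernelWard (bdd_of_decays bdd_of_biLoc)
open AffineAveraging (box toSite)
open AveragingContoursRooted (ctr ctrOff ctrOff_mem_box)
open OneStepResolventKernel (Fib KInv LocStencil decays_mono)
open OneStepKernelFamily (KInvStep decays_KInvStep colH vertexOfK)
open InterLevelTransport (SLam cwsum cwsum_apply)
open BalabanStepJets (lamCoeffOf)
open BalabanStepJetsSucc (lamCoeffK E2 wVH wΛ decays_E2 decays_comp)
open BalabanStepW2 (wM1)
open SecondOrderResponse (colM vertexOfM dM)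
open Summit.QuantumFields.BalabanUV.Beta.TameKernelCalculus
open Summit.QuantumFields.BalabanUV.Beta.AxialDressingRooted (one_le_of_neZero)
open Summit.QuantumFields.BalabanUV.Beta.BorderedHessian (bhK bhK_inr_inr bhKAt bhKAt_inl_inl decays_bhK bhKStep bhKStep_zero spr_bhKStep KInvStep_zero_eq)
open Summit.QuantumFields.BalabanUV.Beta.ChartConjugationReflection (vertexOfK_add abs_le_of_locStencil)
open Summit.QuantumFields.BalabanUV.Beta.LagrangeFold (vertexOfK_smul_SLam_lamCoeffK E2_inr_col)
open Summit.QuantumFields.BalabanUV.Beta.LagrangeFoldStep (wVH_ne_zero wΛ_eq_wM1_mul_wVH)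
open Summit.QuantumFields.BalabanUV.Beta.LagrangeFoldZero (lamCoeffOf_eq_lamCoeffK wM1_zero)
open Summit.QuantumFields.BalabanUV.Beta.LagrangeFoldMixed (mm_mixed_sandwich_eq_neg comp_KInvStep_bhKStep_zero_inr_inl KInvStep_inr_inr_of_col_off
  colM_mixed_sandwich_E2_sym)
open Summit.QuantumFields.BalabanUV.Beta.SymmetrisedStepJets (Gsym Gsym_apply decays_Gsym)
open Summit.QuantumFields.BalabanUV.Beta.RelInvFactorSandwich (comp_bhKStep_Gsym_inr_inr)
open Summit.QuantumFields.BalabanUV.Beta.WardLocusSymSockets (colM_Gsym)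
open Summit.QuantumFields.BalabanUV.Beta.SpineRooted (M1Of M1Of_apply S0NOf SpureRecOf SpureRecOf_zero_level SpureRecOf_succ locStencil_SpureRecOf
  locStencil_SrecOf SrecOf_eq_SpureRecOf_add_lam_zero SrecOf_eq_SpureRecOf_add_lam_succ)
open Summit.QuantumFields.BalabanUV.Beta.WardLocusRecursive (SrecOf SrecOf_zero SrecOf_succ)

namespace Summit.QuantumFields.BalabanUV.Beta.LagrangeFoldSym

variable {d Lc : ℕ} [NeZero Lc]

/-! ## §1 The multiplier-column vertex of the mixed sandwiches -/

/-- [folklore] **THE MULTIPLIER-COLUMN VERTEX OF THE MIXED SANDWICH, LEVEL `j+1`**: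
`vertexOfM (KInvStep Lc (j+1) ∘ E2 (j+1) ∘ Gsym Lc (j+1)) Lc Q μ y = −(wVH (j+1))⁻¹ • vertexOfM (Gsym Lc (j+1)) Lc Q μ y` (any table `Q`). -/
theorem vertexOfM_mixed_sandwich_E2_sym (j : ℕ) {Q : Fin (d + 1) → (Fin (d + 1) → ℤ) → MKer (d + 1) (Fib d)} (μ : Fin (d + 1))
    (y : Fin (d + 1) → ℤ) :
    vertexOfM (comp (comp (KInvStep (d := d) Lc (j + 1)) (E2 d Lc (j + 1))) (Gsym (d := d) Lc (j + 1))) Lc Q μ y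
      = -((wVH d Lc (j + 1))⁻¹ • vertexOfM (Gsym (d := d) Lc (j + 1)) Lc Q μ y) := by
  funext x z a b
  simp only [vertexOfM, cwsum_apply, Pi.neg_apply, Pi.smul_apply, smul_eq_mul, Finset.mul_sum, ← Finset.sum_neg_distrib]
  refine Finset.sum_congr rfl fun ρ' _ => ?_
  rw [← tsum_mul_left, ← tsum_neg]
  refine tsum_congr fun w => ?_
  rw [colM_mixed_sandwich_E2_sym (d := d) (Lc := Lc) j μ y ρ' w]
  ring

/-- [folklore] **THE MULTIPLIER COLUMN OF THE MIXED SANDWICH, LEVEL `0`, FOR ANY KERNEL `H₀` WHOSE ONLY BLOCK IS THE FIELD BLOCK OF `bhK Lc`**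
(step 1's `colM_mixed_sandwich_zero_sym` with `H₀` characterised by its blocks rather than by a `match`, so that callers may supply their own term):
`colM (KInvStep Lc 0 ∘ H₀ ∘ Gsym Lc 0) Lc μ y ρ′ w = −colM (Gsym Lc 0) Lc μ y ρ′ w`. -/
theorem colM_mixed_sandwich_zero_sym' {H₀ : MKer (d + 1) (Fib d)}
    (hHff : ∀ x z (κ l : Fin (d + 1)), H₀ x z (Sum.inl κ) (Sum.inl l) = bhK (d := d) Lc x z (Sum.inl κ) (Sum.inl l))
    (hHfm : ∀ x z (κ ν : Fin (d + 1)), H₀ x z (Sum.inl κ) (Sum.inr ν) = 0) (hHmf : ∀ x z (ν l : Fin (d + 1)), H₀ x z (Sum.inr ν) (Sum.inl l) = 0)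
    (hHmm : ∀ x z (ν ν' : Fin (d + 1)), H₀ x z (Sum.inr ν) (Sum.inr ν') = 0)
    (μ : Fin (d + 1)) (y : Fin (d + 1) → ℤ) (ρ' : Fin (d + 1)) (w : Fin (d + 1) → ℤ) :
    colM (comp (comp (KInvStep (d := d) Lc 0) H₀) (Gsym (d := d) Lc 0)) Lc μ y ρ' w = -colM (Gsym (d := d) Lc 0) Lc μ y ρ' w := by
  obtain ⟨CM, δM, hδM, hMd⟩ := spr_bhKStep (d := d) (Lc := Lc) 0
  have hHff' : ∀ x z (κ l : Fin (d + 1)), H₀ x z (Sum.inl κ) (Sum.inl l) = bhKStep d Lc 0 x z (Sum.inl κ) (Sum.inl l) :=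
    fun x z κ l => by rw [bhKStep_zero]; exact hHff x z κ l
  have hMmm : ∀ x z (ν ν' : Fin (d + 1)), bhKStep d Lc 0 x z (Sum.inr ν) (Sum.inr ν') = 0 := fun x z ν ν' => by
    rw [bhKStep_zero, bhK_inr_inr]
  have hkkt := mm_mixed_sandwich_eq_neg (N := Lc) (A := KInvStep (d := d) Lc 0) (M := bhKStep d Lc 0) (G := Gsym (d := d) Lc 0) (H := H₀)
    (decays_KInvStep (Lc := Lc) (d := d) 0) (decays_Gsym (d := d) Lc 0) ⟨CM, fun x z a b => bdd_of_decays hMd hδM.le x z a b⟩ hMmm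
    hHff' hHfm hHmf hHmm (fun x v m l => comp_KInvStep_bhKStep_zero_inr_inl (d := d) (Lc := Lc) x v m l)
    (fun u z ν m' hu => comp_bhKStep_Gsym_inr_inr (d := d) (Lc := Lc) 0 u z ν m' hu)
    (fun x u m ν hu => KInvStep_inr_inr_of_col_off (d := d) (Lc := Lc) 0 x u m ν hu)
    ((Lc : ℤ) • w) ((Lc : ℤ) • y) ρ' μ
  rw [colM_Gsym (d := d) (Lc := Lc) 0]
  simp only [colM]
  exact hkkt

/-- [folklore] **THE MULTIPLIER-COLUMN VERTEX OF THE MIXED SANDWICH, LEVEL `0`** (any `H₀` whose only block is the field block of `bhK Lc`):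
`vertexOfM (KInvStep Lc 0 ∘ H₀ ∘ Gsym Lc 0) Lc Q μ y = −vertexOfM (Gsym Lc 0) Lc Q μ y`. -/
theorem vertexOfM_mixed_sandwich_zero_sym {H₀ : MKer (d + 1) (Fib d)}
    (hHff : ∀ x z (κ l : Fin (d + 1)), H₀ x z (Sum.inl κ) (Sum.inl l) = bhK (d := d) Lc x z (Sum.inl κ) (Sum.inl l))
    (hHfm : ∀ x z (κ ν : Fin (d + 1)), H₀ x z (Sum.inl κ) (Sum.inr ν) = 0) (hHmf : ∀ x z (ν l : Fin (d + 1)), H₀ x z (Sum.inr ν) (Sum.inl l) = 0)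
    (hHmm : ∀ x z (ν ν' : Fin (d + 1)), H₀ x z (Sum.inr ν) (Sum.inr ν') = 0)
    {Q : Fin (d + 1) → (Fin (d + 1) → ℤ) → MKer (d + 1) (Fib d)} (μ : Fin (d + 1)) (y : Fin (d + 1) → ℤ) :
    vertexOfM (comp (comp (KInvStep (d := d) Lc 0) H₀) (Gsym (d := d) Lc 0)) Lc Q μ y = -vertexOfM (Gsym (d := d) Lc 0) Lc Q μ y := by
  funext x z a b
  simp only [vertexOfM, cwsum_apply, Pi.neg_apply, ← Finset.sum_neg_distrib, ← tsum_neg]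
  refine Finset.sum_congr rfl fun ρ' _ => tsum_congr fun w => ?_
  rw [colM_mixed_sandwich_zero_sym' (d := d) (Lc := Lc) hHff hHfm hHmf hHmm μ y ρ' w]
  ring

/-! ## §2 The Λ-fold with STRAIGHT coefficients read through the SYMMETRISED resolvents -/

/-- [folklore] **LEVEL `j+1`**: for every bounded coarse-bond table `Q`,
`vertexOfK (Gsym Lc (j+1)) Lc (κ u ↦ c • SLam Lc (lamCoeffK (KInvStep Lc (j+1)) (E2 (j+1)) Lc) Q κ u) μ y = (c ∕ wVH (j+1)) • vertexOfM (Gsym Lc (j+1)) Lc Q μ y`. -/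
theorem vertexOfK_lagrangePiece_sym_succ (j : ℕ) {Q : Fin (d + 1) → (Fin (d + 1) → ℤ) → MKer (d + 1) (Fib d)} {B : ℝ}
    (hQ : ∀ ρ' w x z a b, |Q ρ' w x z a b| ≤ B) (c : ℝ) (μ : Fin (d + 1)) (y : Fin (d + 1) → ℤ) :
    vertexOfK (Gsym (d := d) Lc (j + 1)) Lc (fun κ u => c • SLam Lc (lamCoeffK (KInvStep (d := d) Lc (j + 1)) (E2 d Lc (j + 1)) Lc) Q κ u) μ y
      = (c / wVH d Lc (j + 1)) • vertexOfM (Gsym (d := d) Lc (j + 1)) Lc Q μ y := by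
  have hG := decays_Gsym (d := d) Lc (j + 1)
  have hAE : ∃ δ C : ℝ, 0 < δ ∧ 0 ≤ C ∧ Decays (comp (KInvStep (d := d) Lc (j + 1)) (E2 d Lc (j + 1))) C δ := by
    obtain ⟨δ₁, C₁, hδ₁, hC₁, h₁⟩ := decays_KInvStep (Lc := Lc) (d := d) (j + 1)
    obtain ⟨δ₂, C₂, hδ₂, hC₂, h₂⟩ := decays_E2 (d := d) (Lc := Lc) (j + 1)
    have h₁' : Decays (KInvStep (d := d) Lc (j + 1)) C₁ (min δ₁ δ₂) := decays_mono h₁ hC₁ le_rfl (min_le_left _ _)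
    have h₂' : Decays (E2 d Lc (j + 1)) C₂ (min δ₁ δ₂) := decays_mono h₂ hC₂ le_rfl (min_le_right _ _)
    have hm : 0 < min δ₁ δ₂ := lt_min hδ₁ hδ₂
    exact ⟨min δ₁ δ₂ / 2, _, half_pos hm, (decays_comp h₁' h₂' (half_pos hm).le (half_lt_self hm)).nonneg (Sum.inl 0),
      decays_comp h₁' h₂' (half_pos hm).le (half_lt_self hm)⟩
  rw [vertexOfK_smul_SLam_lamCoeffK (N := Lc) hG hAE (fun v u h ν => E2_inr_col Lc (j + 1) v u h ν) hQ c μ y,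
    vertexOfM_mixed_sandwich_E2_sym j μ y, smul_neg, neg_neg, smul_smul, div_eq_mul_inv]

/-- [folklore] **LEVEL `0`**: for every bounded coarse-bond table `Q`,
`vertexOfK (Gsym Lc 0) Lc (κ u ↦ c • SLam Lc (lamCoeffOf (KInv Lc) Lc) Q κ u) μ y = c • vertexOfM (Gsym Lc 0) Lc Q μ y` — the finite-range level-0
coefficients are `lamCoeffK (KInv Lc) H₀` for `H₀` the field block of `bhK Lc` (`LagrangeFoldZero.lamCoeffOf_eq_lamCoeffK`, `bhKAt_inl_inl`), then §1. -/
theorem vertexOfK_lagrangePiece_sym_zero {Q : Fin (d + 1) → (Fin (d + 1) → ℤ) → MKer (d + 1) (Fib d)} {B : ℝ}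
    (hQ : ∀ ρ' w x z a b, |Q ρ' w x z a b| ≤ B) (c : ℝ) (μ : Fin (d + 1)) (y : Fin (d + 1) → ℤ) :
    vertexOfK (Gsym (d := d) Lc 0) Lc (fun κ u => c • SLam Lc (lamCoeffOf (KInv (N := Lc) (d := d)) Lc) Q κ u) μ y
      = c • vertexOfM (Gsym (d := d) Lc 0) Lc Q μ y := by
  have hLc : 1 ≤ Lc := one_le_of_neZero Lc
  set H₀ : MKer (d + 1) (Fib d) := fun x z a b => match a, b with
    | Sum.inl κ, Sum.inl l => bhK (d := d) Lc x z (Sum.inl κ) (Sum.inl l)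
    | _, _ => 0 with hH
  have hcoef : lamCoeffOf (KInv (N := Lc) (d := d)) Lc = lamCoeffK (KInvStep (d := d) Lc 0) H₀ Lc := by
    rw [KInvStep_zero_eq]
    funext μ' y' κ' u'
    exact lamCoeffOf_eq_lamCoeffK (ctr (d + 1) Lc) (KInv (N := Lc) (d := d)) H₀ (fun x z κ l => by rw [hH, bhKAt_inl_inl])
      (fun x z ν l => rfl) μ' y' κ' u'
  have hG := decays_Gsym (d := d) Lc 0
  -- `H₀` decays (entries dominated by those of `bhK`)
  have hH₀ : ∃ δ C : ℝ, 0 < δ ∧ 0 ≤ C ∧ Decays H₀ C δ := by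
    have hMd := decays_bhK (d := d) hLc (show (0 : ℝ) ≤ 1 from zero_le_one)
    refine ⟨1, _, one_pos, hMd.nonneg (Sum.inl 0), fun x z a b => ?_⟩
    rcases a with κ | ν <;> rcases b with l | ν'
    · exact hMd x z (Sum.inl κ) (Sum.inl l)
    all_goals
      simp only [hH, abs_zero]
      exact (abs_nonneg _).trans (hMd x z (Sum.inl 0) (Sum.inl 0))
  have hAE : ∃ δ C : ℝ, 0 < δ ∧ 0 ≤ C ∧ Decays (comp (KInvStep (d := d) Lc 0) H₀) C δ := by
    obtain ⟨δ₁, C₁, hδ₁, hC₁, h₁⟩ := decays_KInvStep (Lc := Lc) (d := d) 0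
    obtain ⟨δ₂, C₂, hδ₂, hC₂, h₂⟩ := hH₀
    have h₁' : Decays (KInvStep (d := d) Lc 0) C₁ (min δ₁ δ₂) := decays_mono h₁ hC₁ le_rfl (min_le_left _ _)
    have h₂' : Decays H₀ C₂ (min δ₁ δ₂) := decays_mono h₂ hC₂ le_rfl (min_le_right _ _)
    have hm : 0 < min δ₁ δ₂ := lt_min hδ₁ hδ₂
    exact ⟨min δ₁ δ₂ / 2, _, half_pos hm, (decays_comp h₁' h₂' (half_pos hm).le (half_lt_self hm)).nonneg (Sum.inl 0),
      decays_comp h₁' h₂' (half_pos hm).le (half_lt_self hm)⟩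
  have hE : ∀ v u (h : Fib d) (ν : Fin (d + 1)), H₀ v u h (Sum.inr ν) = 0 := fun v u h ν => by cases h <;> rfl
  rw [hcoef, vertexOfK_smul_SLam_lamCoeffK (N := Lc) hG hAE hE hQ c μ y,
    vertexOfM_mixed_sandwich_zero_sym (H₀ := H₀) (fun x z κ l => rfl) (fun x z κ ν => rfl) (fun x z ν l => rfl) (fun x z ν ν' => rfl) μ y,
    smul_neg, neg_neg]

/-! ## §3 With the weights of `SrecOf`: the Λ-sector is the multiplier-column vertex of `M1Of H cΛ` -/

/-- [folklore] **LEVEL `j+1`**: `vertexOfK (Gsym Lc (j+1)) Lc (κ u ↦ (cΛ·wΛ (j+1)) • SLam Lc (lamCoeffK (KInvStep Lc (j+1)) (E2 (j+1)) Lc) H κ u) μ y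
= vertexOfM (Gsym Lc (j+1)) Lc (M1Of d Lc H cΛ (j+1)) μ y` for every bounded table `H` (`wΛ = wM1·wVH`). -/
theorem vertexOfK_lagrangePiece_sym_eq_M1Of_succ (j : ℕ) {H : Fin (d + 1) → (Fin (d + 1) → ℤ) → MKer (d + 1) (Fib d)} {B : ℝ}
    (hH : ∀ ρ' w x z a b, |H ρ' w x z a b| ≤ B) (cΛ : ℝ) (μ : Fin (d + 1)) (y : Fin (d + 1) → ℤ) :
    vertexOfK (Gsym (d := d) Lc (j + 1)) Lc
        (fun κ u => (cΛ * wΛ d Lc (j + 1)) • SLam Lc (lamCoeffK (KInvStep (d := d) Lc (j + 1)) (E2 d Lc (j + 1)) Lc) H κ u) μ y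
      = vertexOfM (Gsym (d := d) Lc (j + 1)) Lc (M1Of d Lc H cΛ (j + 1)) μ y := by
  rw [vertexOfK_lagrangePiece_sym_succ j hH _ μ y]
  have hw : wVH d Lc (j + 1) ≠ 0 := wVH_ne_zero (j + 1)
  have hc : cΛ * wΛ d Lc (j + 1) / wVH d Lc (j + 1) = cΛ * wM1 d Lc (j + 1) := by
    rw [wΛ_eq_wM1_mul_wVH]; field_simp
  rw [hc]
  funext x z a b
  simp only [Pi.smul_apply, smul_eq_mul, vertexOfM, cwsum_apply, M1Of_apply, Finset.mul_sum]
  refine Finset.sum_congr rfl fun ρ' _ => ?_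
  rw [← tsum_mul_left]
  exact tsum_congr fun w => by ring

/-- [folklore] **LEVEL `0`**: `vertexOfK (Gsym Lc 0) Lc (κ u ↦ cΛ • SLam Lc (lamCoeffOf (KInv Lc) Lc) H κ u) μ y = vertexOfM (Gsym Lc 0) Lc (M1Of d Lc H cΛ 0) μ y`
(`wM1 0 = 1`). -/
theorem vertexOfK_lagrangePiece_sym_eq_M1Of_zero {H : Fin (d + 1) → (Fin (d + 1) → ℤ) → MKer (d + 1) (Fib d)} {B : ℝ}
    (hH : ∀ ρ' w x z a b, |H ρ' w x z a b| ≤ B) (cΛ : ℝ) (μ : Fin (d + 1)) (y : Fin (d + 1) → ℤ) :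
    vertexOfK (Gsym (d := d) Lc 0) Lc (fun κ u => cΛ • SLam Lc (lamCoeffOf (KInv (N := Lc) (d := d)) Lc) H κ u) μ y
      = vertexOfM (Gsym (d := d) Lc 0) Lc (M1Of d Lc H cΛ 0) μ y := by
  rw [vertexOfK_lagrangePiece_sym_zero hH cΛ μ y]
  funext x z a b
  simp only [Pi.smul_apply, smul_eq_mul, vertexOfM, cwsum_apply, M1Of_apply, wM1_zero, mul_one, Finset.mul_sum]
  refine Finset.sum_congr rfl fun ρ' _ => ?_
  rw [← tsum_mul_left]
  exact tsum_congr fun w => by ring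

/-! ## §4 (c1) at the symmetrised resolvents for the slotted tables, every level -/

/-- [folklore] **ORDER-ONE CONSISTENCY (c1) AT THE SYMMETRISED RESOLVENTS FOR THE SLOTTED FIRST-ORDER TABLES, EVERY LEVEL**: for any border table
`V` with (LV), any constraint-Hessian table `H` with (LH), and the multiplier tables `M1Of d Lc H cΛ`:
`dM (Gsym Lc j) Lc (SpureRecOf d Lc V H (Gsym Lc) cE cVH cΛ j) (M1Of d Lc H cΛ j) μ y = vertexOfK (Gsym Lc j) Lc (SrecOf d Lc V H (Gsym Lc) cE cVH cΛ j) μ y`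
(the Λ-split of `SrecOf` + `vertexOfK_add` with the uniform bounds of `SpureRecOf`∕`SrecOf` + §3). -/
theorem dM_SpureRecOf_M1Of_eq_vertexOfK_SrecOf {V H : Fin (d + 1) → (Fin (d + 1) → ℤ) → MKer (d + 1) (Fib d)}
    (hV : ∀ δ : ℝ, 0 ≤ δ → ∃ C : ℝ, LocStencil V C δ) (hH : ∀ δ : ℝ, 0 ≤ δ → ∃ C : ℝ, VertexFamily H Lc C δ) (cE cVH cΛ : ℝ) :
    ∀ (j : ℕ) (μ : Fin (d + 1)) (y : Fin (d + 1) → ℤ),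
      dM (Gsym (d := d) Lc j) Lc (SpureRecOf d Lc V H (Gsym Lc) cE cVH cΛ j) (M1Of d Lc H cΛ j) μ y =
        vertexOfK (Gsym (d := d) Lc j) Lc (SrecOf d Lc V H (Gsym Lc) cE cVH cΛ j) μ y := by
  have hLc : 1 ≤ Lc := one_le_of_neZero Lc
  -- a uniform entry bound on `H` (from (LH) at rate 0)
  obtain ⟨CH, hHv⟩ := hH 0 le_rfl
  have hHb : ∀ ρ' w x z a b, |H ρ' w x z a b| ≤ CH := fun ρ' w x z a b => bdd_of_biLoc (hHv ρ' w) le_rfl x z a b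
  intro j μ y
  -- uniform entry bounds on the pure and the folded tables, hence on the Λ-piece = their difference
  obtain ⟨Cs, δs, hδs, hS⟩ := locStencil_SpureRecOf (d := d) hLc hV hH (decays_Gsym Lc) cE cVH cΛ j
  obtain ⟨Cf, δf, hδf, hF⟩ := locStencil_SrecOf (d := d) hLc hV hH (decays_Gsym Lc) cE cVH cΛ j
  have hSb : ∀ κ' u x z a b, |SpureRecOf d Lc V H (Gsym Lc) cE cVH cΛ j κ' u x z a b| ≤ max Cs (Cs + Cf) :=
    fun κ' u x z a b => (abs_le_of_locStencil hS hδs.le κ' u x z a b).trans (le_max_left _ _)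
  rcases j with _ | j
  · -- level 0
    set PΛ : Fin (d + 1) → (Fin (d + 1) → ℤ) → MKer (d + 1) (Fib d) := fun κ' u' =>
      cΛ • SLam Lc (lamCoeffOf (KInv (N := Lc) (d := d)) Lc) H κ' u' with hPΛ
    have e : SrecOf d Lc V H (Gsym Lc) cE cVH cΛ 0 = fun κ' u' => SpureRecOf d Lc V H (Gsym Lc) cE cVH cΛ 0 κ' u' + PΛ κ' u' := by
      funext κ' u'; exact SrecOf_eq_SpureRecOf_add_lam_zero V H (Gsym Lc) cE cVH cΛ κ' u'
    have hΛb : ∀ κ' u x z a b, |PΛ κ' u x z a b| ≤ max Cs (Cs + Cf) := by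
      intro κ' u x z a b
      have h1 : PΛ κ' u x z a b = SrecOf d Lc V H (Gsym Lc) cE cVH cΛ 0 κ' u x z a b - SpureRecOf d Lc V H (Gsym Lc) cE cVH cΛ 0 κ' u x z a b := by
        rw [e]; simp only [Pi.add_apply]; ring
      rw [h1]
      refine (abs_sub _ _).trans ((add_le_add (abs_le_of_locStencil hF hδf.le κ' u x z a b) (abs_le_of_locStencil hS hδs.le κ' u x z a b)).trans ?_)
      rw [add_comm]; exact le_max_right _ _
    rw [e, vertexOfK_add (decays_Gsym (d := d) Lc 0) hSb hΛb, SecondOrderResponse.dM]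
    congr 1
    exact (vertexOfK_lagrangePiece_sym_eq_M1Of_zero hHb cΛ μ y).symm
  · -- level j+1
    set PΛ : Fin (d + 1) → (Fin (d + 1) → ℤ) → MKer (d + 1) (Fib d) := fun κ' u' =>
      (cΛ * wΛ d Lc (j + 1)) • SLam Lc (lamCoeffK (KInvStep (d := d) Lc (j + 1)) (E2 d Lc (j + 1)) Lc) H κ' u' with hPΛ
    have e : SrecOf d Lc V H (Gsym Lc) cE cVH cΛ (j + 1) =
        fun κ' u' => SpureRecOf d Lc V H (Gsym Lc) cE cVH cΛ (j + 1) κ' u' + PΛ κ' u' := by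
      funext κ' u'; exact SrecOf_eq_SpureRecOf_add_lam_succ V H (Gsym Lc) cE cVH cΛ j κ' u'
    have hΛb : ∀ κ' u x z a b, |PΛ κ' u x z a b| ≤ max Cs (Cs + Cf) := by
      intro κ' u x z a b
      have h1 : PΛ κ' u x z a b = SrecOf d Lc V H (Gsym Lc) cE cVH cΛ (j + 1) κ' u x z a b -
          SpureRecOf d Lc V H (Gsym Lc) cE cVH cΛ (j + 1) κ' u x z a b := by
        rw [e]; simp only [Pi.add_apply]; ring
      rw [h1]
      refine (abs_sub _ _).trans ((add_le_add (abs_le_of_locStencil hF hδf.le κ' u x z a b) (abs_le_of_locStencil hS hδs.le κ' u x z a b)).trans ?_)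
      rw [add_comm]; exact le_max_right _ _
    rw [e, vertexOfK_add (decays_Gsym (d := d) Lc (j + 1)) hSb hΛb, SecondOrderResponse.dM]
    congr 1
    exact (vertexOfK_lagrangePiece_sym_eq_M1Of_succ j hHb cΛ μ y).symm

end Summit.QuantumFields.BalabanUV.Beta.LagrangeFoldSym

end
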